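import Literature.MathematicalPhysics.QuantumLattice.MatrixProductStates
import Literature.MathematicalPhysics.QuantumLattice.HubbardJordanWigner
import Literature.MathematicalPhysics.QuantumLattice.HubbardChainDopedSegmentUpperBound
import Literature.MathematicalPhysics.QuantumLattice.HubbardWave0LiebProofs
import Summits.Ventures.CertifiedManyBodySolver.Statement
import HarnessLib

/-!
# Ventures/CertifiedManyBodySolver — Upper/FMPSConsumer.lean: the Lean consumer of METHOD-fmps Theorem F1

HONEST FRAMING: first certified bounds; not a superconductivity verdict; every number certified or labelled float.

VAR's `F1-LEMMAS.md` v1 (var-1, 2026-08-20T22:20Z), Part A + D1 + F-L2, in the tree's vocabulary. A finite-`N₀` open-segment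
matrix-product state with SITE-DEPENDENT tensors `A : Fin a → MPSTensor 4 D` (D1: `mpsOpenVar`, the per-site generalisation of
`mpsOpen`; a DMRG state with bond dimensions `χ_j ≤ D` is padded with zeros, vector unchanged) is read on the Jordan–Wigner
spin side; if its amplitudes vanish off total site-charge `N₀` (F-L2's conclusion, hypothesis `hN`), the vector is nonzero
(`hne`), and the CERTIFICATE SENTENCE `Re ⟨φ, toSpin H φ⟩ ≤ (a·hi)·Re ⟨φ, φ⟩` holds for the open-chain Hamiltonian
`H = hamiltonian (pathGraph a) t U` (`hE`; checked outside Lean by two exact evaluators + a referee, FORMAT-fmps1 F-V4), then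
`hubbardChainEnergyDensityAt t U p q ≤ hi` whenever `N₀ · q = p · a` (the segment/subadditivity transport
`hubbardChainEnergyDensityAt_le_segment`, Literature p235155, + the homogeneous variational principle
`groundEnergy_mul_norm_le`). Every doped row of CERTIFIED.md (`M1DopedEnergyUpperRow U p q hi`) is then a ONE-HYPOTHESIS typed row.

NOTE ON THE SENTENCE (correcting F1-LEMMAS v1 Part A as written): the certified quantity is the ENERGY PER SITE `R/a ≤ hi`
with `R = ⟨φ, H φ⟩/⟨φ, φ⟩`, so the consumer hypothesis is `Re ⟨φ, H φ⟩ ≤ (a · hi) · Re ⟨φ, φ⟩` — with `hi · Re ⟨φ, φ⟩` alone the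
conclusion would only be `≤ hi / a`.

Convention pin (F-L3): the tree's local basis is `k = n↑ + 2 n↓` (`siteOcc`), JW order site-major ↑ < ↓; a certificate stored in
the `s = 2 n↑ + n↓` convention enters through `A j ∘ π` with `π` the transposition `1 ↔ 2` (exact on the integer data).
Nothing here depends on the pin: the theorem is stated for whatever tensors are supplied.
-/

noncomputable section

open Matrix Finset
open scoped ComplexOrder BigOperators

namespace Summit.Ventures.CertifiedManyBodySolver.Upper

open Literature.MathematicalPhysics.QuantumLattice
open Literature.MathematicalPhysics.QuantumLattice.ThermodynamicLimit

variable {q D : ℕ}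

/-- **D1.** Open-boundary matrix-product state with SITE-DEPENDENT tensors `A j : Fin q → M_D(ℂ)`:
`ψ(σ) = l ⬝ᵥ (A 0^{σ₀} ⋯ A (L−1)^{σ_{L−1}}) r` (no conjugation of `l`), the finite-DMRG / fixed-`N₀` trial vector of
METHOD-fmps. With a constant tensor it is the tree's `mpsOpen` (`mpsOpenVar_const`). -/
def mpsOpenVar (L : ℕ) (A : Fin L → MPSTensor q D) (l r : Fin D → ℂ) : TensorIndex (Fin L) q → ℂ :=
  fun σ => l ⬝ᵥ ((List.ofFn fun j : Fin L => A j (σ j)).prod *ᵥ r)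

/-- `mpsOpenVar` with a site-independent tensor is `mpsOpen`. -/
theorem mpsOpenVar_const (L : ℕ) (A : MPSTensor q D) (l r : Fin D → ℂ) :
    mpsOpenVar L (fun _ => A) l r = mpsOpen L A l r := by
  funext σ
  simp [mpsOpenVar, mpsOpen, wordProduct]

/-- **F-L2, matrix form (telescoping of bond charge labels along a word).** Matrices `M j` (`j < L`) with bond labels
`c : Fin (L+1) → Fin D → ℕ` and site charges `d : Fin L → ℕ` such that every nonzero entry `M j α β ≠ 0` satisfies
`c (j+1) β = c j α + d j`: a nonzero entry of the product `M 0 ⋯ M (L−1)` forces `c L β = c 0 α + Σ_j d j`. -/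
theorem charge_of_prod_entry_ne_zero : ∀ (L : ℕ) (M : Fin L → Matrix (Fin D) (Fin D) ℂ)
    (c : Fin (L + 1) → Fin D → ℕ) (d : Fin L → ℕ),
    (∀ (j : Fin L) (α β : Fin D), M j α β ≠ 0 → c j.succ β = c j.castSucc α + d j) →
    ∀ α β : Fin D, (List.ofFn M).prod α β ≠ 0 → c (Fin.last L) β = c 0 α + ∑ j, d j := by
  intro L
  induction L with
  | zero =>
    intro M c d _ α β h
    simp only [Finset.univ_eq_empty, Finset.sum_empty, add_zero]
    have : α = β := by
      by_contra hne
      exact h (Matrix.one_apply_ne hne)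
    subst this
    rfl
  | succ L ih =>
    intro M c d hM α β h
    rw [List.ofFn_succ, List.prod_cons, Matrix.mul_apply] at h
    obtain ⟨γ, -, hγ⟩ := Finset.exists_ne_zero_of_sum_ne_zero h
    have h0 : M 0 α γ ≠ 0 := left_ne_zero_of_mul hγ
    have hrest : (List.ofFn fun i : Fin L => M i.succ).prod γ β ≠ 0 := right_ne_zero_of_mul hγ
    have hM' : ∀ (j : Fin L) (α β : Fin D), M j.succ α β ≠ 0 →
        (fun i : Fin (L + 1) => c i.succ) j.succ β = (fun i : Fin (L + 1) => c i.succ) j.castSucc α + d j.succ := by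
      intro j α β hj
      have := hM j.succ α β hj
      show c j.succ.succ β = c j.castSucc.succ α + d j.succ
      rw [Fin.succ_castSucc]
      exact this
    have hih := ih (fun i => M i.succ) (fun i => c i.succ) (fun i => d i.succ) hM' γ β hrest
    have h1 := hM 0 α γ h0
    simp only [Fin.castSucc_zero] at h1
    rw [Fin.sum_univ_succ, ← Fin.succ_last, hih, h1]
    ring

/-- **F-L2 for `mpsOpenVar` (block-sparsity ⇒ exact particle number).** If bond charge labels `c` exist with `c 0 = 0` on the
support of `l`, `c L = N₀` on the support of `r`, and every nonzero tensor entry `A j s α β ≠ 0` satisfies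
`c (j+1) β = c j α + siteCharge s` (FORMAT-fmps1 block structure, checked exactly by the evaluators = F-V2), then every nonzero
amplitude of `mpsOpenVar L A l r` has total site charge `N₀` — exactly the hypothesis `hN` of the consumer theorems below. -/
theorem mpsOpenVar_eq_zero_of_charge (L : ℕ) (A : Fin L → MPSTensor 4 D) (l r : Fin D → ℂ) (N₀ : ℕ)
    (c : Fin (L + 1) → Fin D → ℕ)
    (hl : ∀ α, l α ≠ 0 → c 0 α = 0) (hr : ∀ β, r β ≠ 0 → c (Fin.last L) β = N₀)
    (hA : ∀ (j : Fin L) (s : Fin 4) (α β : Fin D), A j s α β ≠ 0 → c j.succ β = c j.castSucc α + siteCharge s) :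
    ∀ k : TensorIndex (Fin L) 4, (∑ x, siteCharge (k x)) ≠ N₀ → mpsOpenVar L A l r k = 0 := by
  intro k hk
  by_contra hne
  unfold mpsOpenVar at hne
  rw [dotProduct] at hne
  obtain ⟨α, -, hα⟩ := Finset.exists_ne_zero_of_sum_ne_zero hne
  have hlα : l α ≠ 0 := left_ne_zero_of_mul hα
  have hPr : ((List.ofFn fun j : Fin L => A j (k j)).prod *ᵥ r) α ≠ 0 := right_ne_zero_of_mul hα
  rw [mulVec, dotProduct] at hPr
  obtain ⟨β, -, hβ⟩ := Finset.exists_ne_zero_of_sum_ne_zero hPr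
  have hP : (List.ofFn fun j : Fin L => A j (k j)).prod α β ≠ 0 := left_ne_zero_of_mul hβ
  have hrβ : r β ≠ 0 := right_ne_zero_of_mul hβ
  have := charge_of_prod_entry_ne_zero L (fun j => A j (k j)) c (fun j => siteCharge (k j))
    (fun j α β h => hA j (k j) α β h) α β hP
  rw [hr β hrβ, hl α hlα, zero_add] at this
  exact hk this.symm

/-- **Abstract consumer (spin side).** Any vector `φ` on the `a`-site spin chain whose amplitudes vanish off total
site-charge `N₀`, which is nonzero, and which satisfies the certificate sentence
`Re ⟨φ, toSpin H φ⟩ ≤ (a · hi) · Re ⟨φ, φ⟩` for `H = hamiltonian (pathGraph a) t U`, bounds the thermodynamic-limit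
energy density at filling `p/q` (`N₀ · q = p · a`): `hubbardChainEnergyDensityAt t U p q ≤ hi`. -/
theorem hubbardChainEnergyDensityAt_le_of_spin_cert (t : ℝ) {U : ℝ} (hU : 0 ≤ U) {p q a N₀ : ℕ}
    (hq : 1 ≤ q) (hp : p ≤ 2 * q) (ha : 1 ≤ a) (hfill : N₀ * q = p * a)
    (φ : TensorIndex (Fin a) 4 → ℂ) (hi : ℝ)
    (hN : ∀ k : TensorIndex (Fin a) 4, (∑ x, siteCharge (k x)) ≠ N₀ → φ k = 0)
    (hne : φ ≠ 0)
    (hE : (star φ ⬝ᵥ (JordanWigner.toSpin (hamiltonian (SimpleGraph.pathGraph a) t U) *ᵥ φ)).re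
            ≤ ((a : ℝ) * hi) * (star φ ⬝ᵥ φ).re) :
    hubbardChainEnergyDensityAt t U p q ≤ hi := by
  -- the Fock-side vector
  set ψ : Fock (Orb (Fin a)) := JordanWigner.toSpinVec.symm φ with hψ
  have hφ : JordanWigner.toSpinVec ψ = φ := by simp [hψ]
  have hψN : IsNParticle N₀ ψ := by
    rw [JordanWigner.isNParticle_iff, hφ]
    exact hN
  have hψne : ψ ≠ 0 := by
    intro h0
    apply hne
    rw [← hφ, h0, map_zero]
  -- move the sentence to the Fock side
  have hEψ : (expect (hamiltonian (SimpleGraph.pathGraph a) t U) ψ).re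
      ≤ ((a : ℝ) * hi) * (star ψ ⬝ᵥ ψ).re := by
    have h1 : star ψ ⬝ᵥ ψ = star φ ⬝ᵥ φ := by
      rw [← JordanWigner.star_toSpinVec_dotProduct, hφ]
    rw [JordanWigner.expect_eq, hφ, h1]
    exact hE
  -- norm is positive
  have hnorm_pos : 0 < (star ψ ⬝ᵥ ψ).re := by
    have h1 : 0 < star ψ ⬝ᵥ ψ :=
      lt_of_le_of_ne (dotProduct_star_self_nonneg ψ) (Ne.symm (mt dotProduct_star_self_eq_zero.1 hψne))
    exact (Complex.pos_iff.1 h1).1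
  -- homogeneous variational principle
  have hvar := LiebThm1.groundEnergy_mul_norm_le (hamiltonian (SimpleGraph.pathGraph a) t U) hψN
  have hG : groundEnergyAt (SimpleGraph.pathGraph a) t U N₀ ≤ (a : ℝ) * hi := by
    unfold groundEnergyAt
    have := hvar.trans hEψ
    exact le_of_mul_le_mul_right this hnorm_pos
  have haR : (0 : ℝ) < a := by exact_mod_cast ha
  have h1 := hubbardChainEnergyDensityAt_le_segment t hU hq hp ha hfill
  calc hubbardChainEnergyDensityAt t U p q
      ≤ groundEnergyAt (SimpleGraph.pathGraph a) t U N₀ / a := h1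
    _ ≤ ((a : ℝ) * hi) / a := div_le_div_of_nonneg_right hG haR.le
    _ = hi := by field_simp

/-- **F1 consumer (Part A of F1-LEMMAS).** The abstract consumer instantiated on the site-dependent open MPS
`φ = mpsOpenVar a A l r`: from (F-L2) charge support `N₀`, (F-L4a) `φ ≠ 0` and (F-L4b) the certificate sentence
`Re ⟨φ, toSpin H φ⟩ ≤ (a · hi) · Re ⟨φ, φ⟩`, `hubbardChainEnergyDensityAt t U p q ≤ hi` for `N₀ · q = p · a`. -/
theorem hubbardChainEnergyDensityAt_le_of_fmps_cert (t : ℝ) {U : ℝ} (hU : 0 ≤ U) {p q a N₀ : ℕ}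
    (hq : 1 ≤ q) (hp : p ≤ 2 * q) (ha : 1 ≤ a) (hfill : N₀ * q = p * a) {D : ℕ}
    (A : Fin a → MPSTensor 4 D) (l r : Fin D → ℂ) (hi : ℝ)
    (hN : ∀ k : TensorIndex (Fin a) 4, (∑ x, siteCharge (k x)) ≠ N₀ → mpsOpenVar a A l r k = 0)
    (hne : mpsOpenVar a A l r ≠ 0)
    (hE : (star (mpsOpenVar a A l r) ⬝ᵥ
            (JordanWigner.toSpin (hamiltonian (SimpleGraph.pathGraph a) t U) *ᵥ mpsOpenVar a A l r)).re
            ≤ ((a : ℝ) * hi) * (star (mpsOpenVar a A l r) ⬝ᵥ mpsOpenVar a A l r).re) :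
    hubbardChainEnergyDensityAt t U p q ≤ hi :=
  hubbardChainEnergyDensityAt_le_of_spin_cert t hU hq hp ha hfill (mpsOpenVar a A l r) hi hN hne hE

/-- The doped Venture row from an F1 certificate: `M1DopedEnergyUpperRow U p q hi` (`Statement.lean`) with a rational `hi`. -/
theorem m1DopedEnergyUpperRow_of_fmps_cert {U : ℝ} (hU : 0 ≤ U) {p q a N₀ : ℕ}
    (hq : 1 ≤ q) (hp : p ≤ 2 * q) (ha : 1 ≤ a) (hfill : N₀ * q = p * a) {D : ℕ}
    (A : Fin a → MPSTensor 4 D) (l r : Fin D → ℂ) (hi : ℚ)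
    (hN : ∀ k : TensorIndex (Fin a) 4, (∑ x, siteCharge (k x)) ≠ N₀ → mpsOpenVar a A l r k = 0)
    (hne : mpsOpenVar a A l r ≠ 0)
    (hE : (star (mpsOpenVar a A l r) ⬝ᵥ
            (JordanWigner.toSpin (hamiltonian (SimpleGraph.pathGraph a) 1 U) *ᵥ mpsOpenVar a A l r)).re
            ≤ ((a : ℝ) * (hi : ℝ)) * (star (mpsOpenVar a A l r) ⬝ᵥ mpsOpenVar a A l r).re) :
    M1DopedEnergyUpperRow U p q hi :=
  hubbardChainEnergyDensityAt_le_of_fmps_cert 1 hU hq hp ha hfill A l r (hi : ℝ) hN hne hE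

/-- **F1 consumer with block data (Part A + F-L2).** The doped Venture row from the certificate's BLOCK-SPARSITY data
(bond labels `c`, F-V2) instead of the abstract charge hypothesis: `M1DopedEnergyUpperRow U p q hi`. -/
theorem m1DopedEnergyUpperRow_of_fmps_cert_blocks {U : ℝ} (hU : 0 ≤ U) {p q a N₀ : ℕ}
    (hq : 1 ≤ q) (hp : p ≤ 2 * q) (ha : 1 ≤ a) (hfill : N₀ * q = p * a) {D : ℕ}
    (A : Fin a → MPSTensor 4 D) (l r : Fin D → ℂ) (hi : ℚ) (c : Fin (a + 1) → Fin D → ℕ)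
    (hl : ∀ α, l α ≠ 0 → c 0 α = 0) (hr : ∀ β, r β ≠ 0 → c (Fin.last a) β = N₀)
    (hA : ∀ (j : Fin a) (s : Fin 4) (α β : Fin D), A j s α β ≠ 0 → c j.succ β = c j.castSucc α + siteCharge s)
    (hne : mpsOpenVar a A l r ≠ 0)
    (hE : (star (mpsOpenVar a A l r) ⬝ᵥ
            (JordanWigner.toSpin (hamiltonian (SimpleGraph.pathGraph a) 1 U) *ᵥ mpsOpenVar a A l r)).re
            ≤ ((a : ℝ) * (hi : ℝ)) * (star (mpsOpenVar a A l r) ⬝ᵥ mpsOpenVar a A l r).re) :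
    M1DopedEnergyUpperRow U p q hi :=
  m1DopedEnergyUpperRow_of_fmps_cert hU hq hp ha hfill A l r hi
    (mpsOpenVar_eq_zero_of_charge a A l r N₀ c hl hr hA) hne hE

end Summit.Ventures.CertifiedManyBodySolver.Upper

end
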